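import Summits.BirchSwinnertonDyer.BirchSwinnertonDyer.Theorems.AdditiveBranchIMCGordTwoRankZeroCompanionDoors
import HarnessLib

/-!
# Crux `GordTwoRankZeroOffCaseOne` (item 19357): the companion / visibility doors, TWIST-MODEL form with the
# SIX-option local dispatch (kinds (ii)/(iii)/(iv) at the multiplicative places) — the record shape for partners
# found OUTSIDE the tables (Fisher's Hesse pencils `X_E(5)`, `X_E⁻(5)`), whose LEVEL-RAISING primes are large

Cell `bsd-addord`, seat `bsd-addord-k1-c2` (D-0074 row B1), gen 5. HONEST FRAMING: nothing here proves the
Birch–Swinnerton-Dyer conjecture or the crux; THEOREMS ONLY (no definition, no named fact, no `sorry`);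
per pair (a per-pair record instantiates these shapes); the crux (a ∀-statement) stays OPEN at class level
(seat verdict gens 0–4: the branch main-conjecture lower bound is not in print).

## Why

Gen 4's record shape `missingLowerBoundAt_rankZero_irr_of_twistModels_witness` /
`bsdp_rankZero_surj_of_twistModels_witness` (`…CompanionDoors.lean`) offers, at a place `w ∈ S`, the three
options (a) a `p`-th root of the witness in `W'(ℚ_w)`, (i) `w ∤ p ∧ W'(ℚ_w)[p] = 0`, (vi) `w ∣ p` (both curves
`p*`-twists of curves good at `p`, Mazur–Rubin 2015 twisted). That suffices for partners inside Cremona's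
table (gen 4: 51 records at `p ≥ 5`, 206 at `p = 3`). For the rows WITHOUT a partner of conductor
`< 5·10⁵` the partners come from the genus-`0` moduli `X_E(5)` / `X_E⁻(5)` (Rubin–Silverberg, Fisher 2012;
team b2b x10b gen 16 precedent `Supersingular/X7Visibility5Records08–15`): such a partner `W'` is
multiplicative at one or more LEVEL-RAISING primes `ℓ ∤ N_E` of size `10⁵–10²⁵`, where the kernel decider of
kind (i) (a residue sieve mod `ℓ`) is out of reach, but kind (iv) "one curve NON-split multiplicative, the
other good" (Fisher 2016 Thm. 4.4, named fact `hF44`) is decided by Euler's criterion in `O(log ℓ)` kernel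
multiplications (`Supersingular/NonsplitByEuler.lean`), and kinds (ii)/(iii) (Tate uniformisation `hU`/`hU2`)
serve the target's own multiplicative places. This file is the twist-model form of the six-option door
`missingLowerBoundAt_rankZero_irr_of_companionWitness₆` (same file), i.e. the composition of §2's
`exists_sha_ne_zero_of_congr_of_witness_twist₆` (`…Companion.lean`) with Cassels–Tate squareness, and its
`BSD(E,p)` twin (Kato's upper half on the semistable-twist locus, as in `bsdp_rankZero_surj_of_twistModels_witness`).

## What

* `missingLowerBoundAt_rankZero_irr_of_twistModels_witness₆` — `ord_p #Ш(E)_an ≤ ord_p #Ш(E)` from: `W = C • V^{(p*)}`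
  with `V` good at `p` (odd `p`), `E[p]` irreducible, `r_an = 0`, `#Ш_an = q` with `ord_p q ≤ 2`; partner
  `W' = C' • V'^{(p*)}` with `V'` good at `p`; `θ : W'[p] ⥲ W[p]`; places `S`; ONE witness `P ∈ W'(ℚ) ∖ pW'(ℚ)`
  with, at each `w ∈ S`, one of the six options (a)/(i)/(ii)/(iii)/(iv)/(vi). Named facts `hCT hGZK hU hU2 hF44 hMRt`.
* `bsdp_rankZero_surj_of_twistModels_witness₆` — `BSD(E,p)`, `p ≥ 5`, `ρ̄_{E,p}` onto, `Addv W p`, `GoodOrd V p`: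
  the lower half above + Kato's upper half (`Addv.missingUpperBoundAt_rankZero_of_semistableTwist_of_surj`);
  named facts `+ hK hDel98 hPal hmod hmodD`.

References: Mazur–Rubin 2015 Thm. 3.1, §6 Case 5 [MazurRubin2015SelmerCompanions]; Cremona–Mazur 2000 §3
[CremonaMazur2000]; Agashe–Stein 2002 Lemma 3.6 [AgasheStein2002]; Fisher 2016 Thm. 4.4 [Fisher2016Visualizing7];
Silverman ATAEC V.3.1/V.5.3/V.5.4 [SilvermanATAEC1994]; Silverman AEC X.4.14 [SilvermanAEC2009]; Kato 2004
Thm. 17.4 [Kato2004Asterisque]; Delbourgo 1998 Prop. 4 [Delbourgo1998]; Pal 2012 Thm. 3.2 [Pal2012]; Miller 2011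
Def. 1.1 [Miller2011LMS]; Fisher 2012 Thm. 13.2 / 5.8 [Fisher2012Hessian]; Rubin–Silverberg 1995 [RubinSilverberg1995].
-/

set_option autoImplicit false

noncomputable section

open scoped Classical

open WeierstrassCurve Literature.NumberTheory.EllipticCurves
  Literature.NumberTheory.EllipticCurves.Rank1Residual
  Literature.NumberTheory.EllipticCurves.Rank1Residual.Typed
  Literature.NumberTheory.EllipticCurves.Wuthrich2014
  Literature.NumberTheory.EllipticCurves.Fisher2016
  Literature.NumberTheory.EllipticCurves.MazurRubin2015
  Literature.NumberTheory.GaloisRepresentations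
  Summit.BirchSwinnertonDyer.Rank1Residual.GaloisImage
open NumberField IsDedekindDomain Rat.HeightOneSpectrum Field
  Literature.NumberTheory.EllipticCurves.ModularForms

set_option linter.dupNamespace false

namespace Summit.BirchSwinnertonDyer.BirchSwinnertonDyer.Theorems.AdditiveBranchIMCGordTwoRankZeroCompanion

open Summit.BirchSwinnertonDyer.Rank1Residual
open Summit.BirchSwinnertonDyer.Rank1Residual.Additive

section DoorsSix

variable {W : WeierstrassCurve ℚ} [W.IsElliptic] [W.IsGloballyMinimal] {p : ℕ} [hp : Fact p.Prime]

omit [W.IsGloballyMinimal] in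
/-- **The LOWER half by visibility, TWIST-MODEL form, SIX-option local dispatch** (the shape a per-pair record with a
partner OUTSIDE the tables instantiates). `W = C • V^{(p*)}` with `V` GOOD at `p` (any odd `p`), `E[p]` irreducible,
`r_an = 0`, `#Ш_an = q` with `ord_p q ≤ 2`; the partner `W' = C' • V'^{(p*)}` with `V'` good at `p`; `θ`, `S`, the
witness `P ∈ W'(ℚ) ∖ pW'(ℚ)` with, at each `w ∈ S`: (a) a `p`-th root of `P` in `W'(ℚ_w)`; or (i) `w ∤ p`,
`W'(ℚ_w)[p] = 0`; or (ii) both split multiplicative with `#W(ℚ_w)[p] ≤ p`; or (iii) both multiplicative of the same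
`γ`-class with `μ_p(ℚ_w) = 1`; or (iv) one non-split multiplicative, the other good; or (vi) `w ∣ p`. Then
`ord_p #Ш(E)_an ≤ ord_p #Ш(E)`. Named facts: Cassels–Tate, GZK, Tate uniformisation (`hU`, `hU2`), Fisher 2016
Thm. 4.4 (`hF44`), Mazur–Rubin 2015 twisted (`hMRt`). Per pair; NOT a class theorem; nothing booked.
[cite: MazurRubin2015SelmerCompanions, Thm. 3.1 and §6 Case 5] [cite: Fisher2016Visualizing7, Thm. 4.4 (p. 106)]
[cite: SilvermanATAEC1994, Ch. V Thm. 3.1, Thm. 5.3, Cor. 5.4] [cite: CremonaMazur2000, §3 and Table 1]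
[cite: AgasheStein2002, Lemma 3.6] [cite: SilvermanAEC2009, Thm. X.4.14] -/
theorem missingLowerBoundAt_rankZero_irr_of_twistModels_witness₆
    (hCT : exists_casselsTate_pairing (K := ℚ)) (hGZK : rank_eq_analyticRank_of_analyticRank_le_one)
    (hU : Silverman1994_thmV53_tateUniformisation.{0})
    (hU2 : Silverman1994_thmV53_corV54_tateUniformisation.{0})
    (hF44 : thm44_selmerLocalKer_iff_of_nonsplit_good)
    (hMRt : selmerLocalKer_iff_of_twist_of_goodReduction_above)
    (hp2 : p ≠ 2) (hirr : Irr W p) (hr : W.analyticRank = 0)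
    {q : ℚ} (hq : shaAn W = (q : ℂ)) (hv : padicValRat p q ≤ 2)
    (V : WeierstrassCurve ℚ) [V.IsElliptic] (C : VariableChange ℚ)
    (hWV : C • V.quadraticTwist ((-1 : ℚ) ^ (p / 2) * p) = W) (hV : V.HasGoodReductionAtPrime p)
    (W' : WeierstrassCurve ℚ) [W'.IsElliptic] (V' : WeierstrassCurve ℚ) [V'.IsElliptic]
    (C' : VariableChange ℚ) (hWV' : C' • V'.quadraticTwist ((-1 : ℚ) ^ (p / 2) * p) = W')
    (hV' : V'.HasGoodReductionAtPrime p)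
    (θ : geomTorsion W' (p : ℤ) ≃+ geomTorsion W (p : ℤ))
    (hθ : ∀ (σ : absoluteGaloisGroup ℚ) (P : geomTorsion W' (p : ℤ)), θ (σ • P) = σ • θ P)
    (S : Finset (HeightOneSpectrum (𝓞 ℚ)))
    (hS : ∀ w : HeightOneSpectrum (𝓞 ℚ), w ∉ S →
      W.HasGoodReductionAt w ∧ W'.HasGoodReductionAt w ∧ (p : 𝓞 ℚ) ∉ w.asIdeal)
    (P : W'.toAffine.Point)
    (hP : P ∉ (zsmulAddGroupHom (p : ℤ) : W'.toAffine.Point →+ W'.toAffine.Point).range)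
    (hplaces : ∀ w ∈ S,
      (∃ Q : (W'.baseChange (w.adicCompletion ℚ)).toAffine.Point,
        p • Q = WeierstrassCurve.Affine.Point.baseChange (W' := W') ℚ (w.adicCompletion ℚ) P) ∨
      ((p : 𝓞 ℚ) ∉ w.asIdeal ∧ Nat.card (nsmulAddMonoidHom p :
          (W'.baseChange (w.adicCompletion ℚ)).toAffine.Point →+ _).ker = 1) ∨
      (W.HasSplitMultiplicativeReductionAt w ∧ W'.HasSplitMultiplicativeReductionAt w ∧
        Nat.card (nsmulAddMonoidHom p :
          (W.baseChange (w.adicCompletion ℚ)).toAffine.Point →+ _).ker ≤ p) ∨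
      (W.HasMultiplicativeReductionAt w ∧ W'.HasMultiplicativeReductionAt w ∧
        (∃ r : w.adicCompletion ℚ, algebraMap ℚ (w.adicCompletion ℚ) (-(W.c₄ / W.c₆)) =
          r ^ 2 * algebraMap ℚ (w.adicCompletion ℚ) (-(W'.c₄ / W'.c₆))) ∧
        (∀ ζ : w.adicCompletion ℚ, ζ ^ p = 1 → ζ = 1)) ∨
      ((W.HasMultiplicativeReductionAt w ∧ ¬ W.HasSplitMultiplicativeReductionAt w ∧
          W'.HasGoodReductionAt w) ∨
        (W.HasGoodReductionAt w ∧ W'.HasMultiplicativeReductionAt w ∧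
          ¬ W'.HasSplitMultiplicativeReductionAt w)) ∨
      ((p : 𝓞 ℚ) ∈ w.asIdeal)) :
    MissingLowerBoundAt W p := by
  haveI hfin : Finite W.toAffine.Point := finite_point_of_analyticRank_eq_zero W hGZK hr
  have hcop : (Nat.card W.toAffine.Point).Coprime p := coprime_natCard_point_of_irr W p hirr
  have hex : ∃ c : W.sha, c ≠ 0 ∧ p • c = 0 :=
    exists_sha_ne_zero_of_congr_of_witness_twist₆ hU hU2 hF44 hMRt hp2 θ hθ V V' C C' (pStar_ne_zero p)
      hWV hWV' hV hV' S hS hfin hcop P hP hplaces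
  have hfinSha : W.ShaFinite := (hGZK W (by rw [hr]; norm_num)).2
  exact missingLowerBoundAt_of_casselsTate_of_pow_dvd W p hCT hfinSha hq (k := 1) (by simpa using hv)
    (by simpa using dvd_shaOrder_of_exists_torsion W p hex)

/-- **`BSD(E,p)` by visibility, TWIST-MODEL form, SIX-option local dispatch, `p ≥ 5`** (the booking shape a
per-pair record with a partner outside the tables instantiates): `E = W` additive at `p` (`Addv W p`) with a
globally minimal good ORDINARY twist model `C • V^{(p*)} = W` (`GoodOrd V p`), `ρ̄_{E,p}` onto, `r_an = 0`,
`#Ш_an = q` with `ord_p q ≤ 2`, and the companion data of `missingLowerBoundAt_rankZero_irr_of_twistModels_witness₆`;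
the UPPER half is Kato's on the semistable-twist locus (`Addv.missingUpperBoundAt_rankZero_of_semistableTwist_of_surj`).
Per pair modulo `hCT hGZK hU hU2 hF44 hMRt hK hDel98 hPal hmod hmodD`; books nothing by itself.
[cite: MazurRubin2015SelmerCompanions, Thm. 3.1 and §6 Case 5] [cite: Fisher2016Visualizing7, Thm. 4.4 (p. 106)]
[cite: SilvermanATAEC1994, Ch. V Thm. 3.1, Thm. 5.3, Cor. 5.4] [cite: CremonaMazur2000, §3 and Table 1]
[cite: Kato2004Asterisque, Thm. 17.4 (3) (p. 273)] [cite: Delbourgo1998, Prop. 4 (p. 144)] [cite: Pal2012, Thm. 3.2]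
[cite: Miller2011LMS, Def. 1.1] -/
theorem bsdp_rankZero_surj_of_twistModels_witness₆
    (hCT : exists_casselsTate_pairing (K := ℚ)) (hGZK : rank_eq_analyticRank_of_analyticRank_le_one)
    (hU : Silverman1994_thmV53_tateUniformisation.{0})
    (hU2 : Silverman1994_thmV53_corV54_tateUniformisation.{0})
    (hF44 : thm44_selmerLocalKer_iff_of_nonsplit_good)
    (hMRt : selmerLocalKer_iff_of_twist_of_goodReduction_above)
    (hK : Wuthrich2014.kato_halfEigenCharIdeal_dvd_cyclotomicPrime_of_surjective)
    (hDel98 : Delbourgo1998.prop4_rankZero_pow_dvd_constantCoeff)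
    (hPal : Pal2012.thm32_sqrt_mul_realPeriodRat_twist_eq_of_prime_one_mod_four)
    (hmod : hasEntireLFunction_rat) (hmodD : nonempty_modularParametrizationData)
    (hadd : Addv W p) (hsurj : Surj W p) (hp5 : 5 ≤ p) (hr : W.analyticRank = 0)
    {q : ℚ} (hq : shaAn W = (q : ℂ)) (hv : padicValRat p q ≤ 2)
    (V : WeierstrassCurve ℚ) [V.IsElliptic] [V.IsGloballyMinimal] (C : VariableChange ℚ)
    (hWV : C • V.quadraticTwist ((-1 : ℚ) ^ (p / 2) * p) = W) (hVord : GoodOrd V p)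
    (W' : WeierstrassCurve ℚ) [W'.IsElliptic] (V' : WeierstrassCurve ℚ) [V'.IsElliptic]
    (C' : VariableChange ℚ) (hWV' : C' • V'.quadraticTwist ((-1 : ℚ) ^ (p / 2) * p) = W')
    (hV' : V'.HasGoodReductionAtPrime p)
    (θ : geomTorsion W' (p : ℤ) ≃+ geomTorsion W (p : ℤ))
    (hθ : ∀ (σ : absoluteGaloisGroup ℚ) (P : geomTorsion W' (p : ℤ)), θ (σ • P) = σ • θ P)
    (S : Finset (HeightOneSpectrum (𝓞 ℚ)))
    (hS : ∀ w : HeightOneSpectrum (𝓞 ℚ), w ∉ S →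
      W.HasGoodReductionAt w ∧ W'.HasGoodReductionAt w ∧ (p : 𝓞 ℚ) ∉ w.asIdeal)
    (P : W'.toAffine.Point)
    (hP : P ∉ (zsmulAddGroupHom (p : ℤ) : W'.toAffine.Point →+ W'.toAffine.Point).range)
    (hplaces : ∀ w ∈ S,
      (∃ Q : (W'.baseChange (w.adicCompletion ℚ)).toAffine.Point,
        p • Q = WeierstrassCurve.Affine.Point.baseChange (W' := W') ℚ (w.adicCompletion ℚ) P) ∨
      ((p : 𝓞 ℚ) ∉ w.asIdeal ∧ Nat.card (nsmulAddMonoidHom p :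
          (W'.baseChange (w.adicCompletion ℚ)).toAffine.Point →+ _).ker = 1) ∨
      (W.HasSplitMultiplicativeReductionAt w ∧ W'.HasSplitMultiplicativeReductionAt w ∧
        Nat.card (nsmulAddMonoidHom p :
          (W.baseChange (w.adicCompletion ℚ)).toAffine.Point →+ _).ker ≤ p) ∨
      (W.HasMultiplicativeReductionAt w ∧ W'.HasMultiplicativeReductionAt w ∧
        (∃ r : w.adicCompletion ℚ, algebraMap ℚ (w.adicCompletion ℚ) (-(W.c₄ / W.c₆)) =
          r ^ 2 * algebraMap ℚ (w.adicCompletion ℚ) (-(W'.c₄ / W'.c₆))) ∧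
        (∀ ζ : w.adicCompletion ℚ, ζ ^ p = 1 → ζ = 1)) ∨
      ((W.HasMultiplicativeReductionAt w ∧ ¬ W.HasSplitMultiplicativeReductionAt w ∧
          W'.HasGoodReductionAt w) ∨
        (W.HasGoodReductionAt w ∧ W'.HasMultiplicativeReductionAt w ∧
          ¬ W'.HasSplitMultiplicativeReductionAt w)) ∨
      ((p : 𝓞 ℚ) ∈ w.asIdeal)) :
    BSDp W p := by
  have hp2 : p ≠ 2 := by omega
  have hirr : Irr W p := hasIrreducibleModPGaloisRep_of_hasSurjectiveModNGaloisRep W p hsurj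
  have hlow : MissingLowerBoundAt W p :=
    missingLowerBoundAt_rankZero_irr_of_twistModels_witness₆ hCT hGZK hU hU2 hF44 hMRt hp2 hirr hr hq hv V C
      hWV hVord.1 W' V' C' hWV' hV' θ hθ S hS P hP hplaces
  exact bsdp_of_missingPPartAt W p hGZK (by omega)
    (missingPPartAt_of_lower_of_upper W p hlow
      (Addv.missingUpperBoundAt_rankZero_of_semistableTwist_of_surj hK hDel98 hPal hGZK hmod hmodD hp5
        hadd V C hWV (Or.inl hVord) hsurj hr))

end DoorsSix

end Summit.BirchSwinnertonDyer.BirchSwinnertonDyer.Theorems.AdditiveBranchIMCGordTwoRankZeroCompanion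

end
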